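import Mathlib
import Summits.Ventures.PercRepro2.V2SP
import Summits.Ventures.PercRepro2.Tail2DCount
import Summits.Ventures.PercRepro2.Tail2DThreePoint
import Summits.Ventures.PercRepro2.Tail2DFlowTwo
import Summits.Ventures.PercRepro2.Tail2DTransport
import Summits.Ventures.PercRepro2.Tail2DP2Series
import Summits.Ventures.PercRepro2.Tail2DDisjointPaths
import Summits.Ventures.PercRepro2.Tail2DThirdInequality
import Summits.Ventures.PercRepro2.Tail2DP2SeriesSP
import Summits.Ventures.PercRepro2.Tail2DAxisUnimodal
import Summits.Ventures.PercRepro2.Tail2DCapOneAlgebra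

/-!
# Two capacity-one pieces in parallel, in series with anything: the transport rule for the family
`(A ∥ B) ∧ Y` (seat mine-b, cell pub-perc-repro2)

`P(e²) ∧ Y` (`Tail2DP2SeriesSP.lean`) is the case `A = B = free` of the family `(A ∥ B) ∧ Y` with
`A`, `B` of capacity one (`FlowLeOne`: every configuration has `r + b ≤ 1`) and `Y` arbitrary. Such a
pattern has max-flow `≤ 2`, and its six flow counts are (`fc20` … `fc00`, with `x = #{r = 1}`,
`z = #{r = b = 0}` of the pieces — `#{b = 1} = #{r = 1}` by the colour swap — and the statistics
`a₁ = #{r ≥ 1}`, `a₂ = #{r ≥ 2}`, `c = #{r ≥ 1 ∧ b ≥ 1}`, `Q = #{r = 1}`, `P = #{r = 0}`,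
`Z = #{r = b = 0}`, `X = #{r ≥ 1 ∧ b = 0}` of `Y`):

  `n₂₀ = n₀₂ = u a₂`, `n₁₁ = 2u c`, `n₁₀ = n₀₁ = v a₁ + u Q + 2u X`, `n₀₀ = w M + 2(u + v) P + 2u Z`,

`u = x_A x_B`, `v = x_A z_B + z_A x_B`, `w = z_A z_B`. The nine transport hypotheses of
`MTailPat.par_flow2'` then follow from the theorems of the grammar — `#{r ≥ 2} ≤ #{r ≥ 1 ∧ b ≥ 1}`
(`disjoint_le_conn`), the third inequality (`third_count`) and Harris (`harris_count`) for `Y` —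
through the identity (`capone_alg`, `Tail2DCapOneAlgebra.lean`)

  `n₁₀² + n₁₀ n₂₀ − n₀₀ n₁₁ = u²·[third-slack] + (v² − 4uw) a₁² + 2uw (a₁² − cM) + 2uw a₁²
                              + uv·(4(a₁² − cM) + a₁(2a₁ − a₂))`,

`v² − 4uw = (x_A z_B − z_A x_B)²`. Hence (`MTailPat.par_serCapOne`) parallel composition with
`(A ∥ B) ∧ Y` keeps M♮ counting tails for all capacity-one `A`, `B` that can carry flow and every
`Y` attaining `r ≥ 2`, `b ≥ 2` and `r, b ≥ 1`.
-/

namespace Summit.Ventures.PercRepro2.Tail2D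

open V2Closure

/-! ### The counts of `(A ∥ B) ∧ Y` -/

section Counts

variable (A B Y : V2Closure.SP)

/-- a product of three indicator sums over the configurations of `(A ∥ B) ∧ Y` -/
lemma sum_prod_ite3 (p : A.Conf → Prop) (q : B.Conf → Prop) (r : Y.Conf → Prop)
    [DecidablePred p] [DecidablePred q] [DecidablePred r] :
    (∑ y : (A.Conf × B.Conf) × Y.Conf, if (p y.1.1 ∧ q y.1.2) ∧ r y.2 then 1 else 0)
      = (∑ a : A.Conf, if p a then 1 else 0) * (∑ b : B.Conf, if q b then 1 else 0) * (∑ c : Y.Conf, if r c then 1 else 0) := by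
  rw [← sum_prod_ite A B p q]
  exact sum_prod_ite (V2Closure.SP.par A B) Y (fun ab => p ab.1 ∧ q ab.2) r

variable (hA : FlowLeOne A) (hB : FlowLeOne B)
include hA hB

/-- `n₂₀ = x_A x_B · #{r ≥ 2}` -/
lemma fc20 : flowCount (V2Closure.SP.ser (V2Closure.SP.par A B) Y) 2 0
    = (Finset.univ.filter (fun a : A.Conf => A.rLab a = 1)).card * (Finset.univ.filter (fun b : B.Conf => B.rLab b = 1)).card
      * (Finset.univ.filter (fun y : Y.Conf => 2 ≤ Y.rLab y)).card := by
  unfold flowCount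
  simp only [Finset.card_filter]
  rw [← sum_prod_ite3 A B Y (fun a => A.rLab a = 1) (fun b => B.rLab b = 1) (fun y => 2 ≤ Y.rLab y)]
  change (∑ y : (A.Conf × B.Conf) × Y.Conf, if min (A.rLab y.1.1 + B.rLab y.1.2) (Y.rLab y.2) = 2
      ∧ min (A.bLab y.1.1 + B.bLab y.1.2) (Y.bLab y.2) = 0 then 1 else 0) = _
  refine Finset.sum_congr rfl (fun y _ => ?_)
  have h1 := hA y.1.1; have h2 := hB y.1.2
  split_ifs <;> omega

/-- `n₀₂ = y_A y_B · #{b ≥ 2}` (with `y = #{b = 1}`) -/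
lemma fc02 : flowCount (V2Closure.SP.ser (V2Closure.SP.par A B) Y) 0 2
    = (Finset.univ.filter (fun a : A.Conf => A.bLab a = 1)).card * (Finset.univ.filter (fun b : B.Conf => B.bLab b = 1)).card
      * (Finset.univ.filter (fun y : Y.Conf => 2 ≤ Y.bLab y)).card := by
  unfold flowCount
  simp only [Finset.card_filter]
  rw [← sum_prod_ite3 A B Y (fun a => A.bLab a = 1) (fun b => B.bLab b = 1) (fun y => 2 ≤ Y.bLab y)]
  change (∑ y : (A.Conf × B.Conf) × Y.Conf, if min (A.rLab y.1.1 + B.rLab y.1.2) (Y.rLab y.2) = 0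
      ∧ min (A.bLab y.1.1 + B.bLab y.1.2) (Y.bLab y.2) = 2 then 1 else 0) = _
  refine Finset.sum_congr rfl (fun y _ => ?_)
  have h1 := hA y.1.1; have h2 := hB y.1.2
  split_ifs <;> omega

/-- `n₁₁ = (x_A y_B + y_A x_B) · #{r ≥ 1 ∧ b ≥ 1}` -/
lemma fc11 : flowCount (V2Closure.SP.ser (V2Closure.SP.par A B) Y) 1 1
    = (Finset.univ.filter (fun a : A.Conf => A.rLab a = 1)).card * (Finset.univ.filter (fun b : B.Conf => B.bLab b = 1)).card
        * (Finset.univ.filter (fun y : Y.Conf => 1 ≤ Y.rLab y ∧ 1 ≤ Y.bLab y)).card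
      + (Finset.univ.filter (fun a : A.Conf => A.bLab a = 1)).card * (Finset.univ.filter (fun b : B.Conf => B.rLab b = 1)).card
        * (Finset.univ.filter (fun y : Y.Conf => 1 ≤ Y.rLab y ∧ 1 ≤ Y.bLab y)).card := by
  unfold flowCount
  simp only [Finset.card_filter]
  rw [← sum_prod_ite3 A B Y (fun a => A.rLab a = 1) (fun b => B.bLab b = 1) (fun y => 1 ≤ Y.rLab y ∧ 1 ≤ Y.bLab y),
    ← sum_prod_ite3 A B Y (fun a => A.bLab a = 1) (fun b => B.rLab b = 1) (fun y => 1 ≤ Y.rLab y ∧ 1 ≤ Y.bLab y)]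
  change (∑ y : (A.Conf × B.Conf) × Y.Conf, if min (A.rLab y.1.1 + B.rLab y.1.2) (Y.rLab y.2) = 1
      ∧ min (A.bLab y.1.1 + B.bLab y.1.2) (Y.bLab y.2) = 1 then 1 else 0) = _
  rw [← Finset.sum_add_distrib]
  refine Finset.sum_congr rfl (fun y _ => ?_)
  have h1 := hA y.1.1; have h2 := hB y.1.2
  split_ifs <;> omega

/-- `n₁₀ = (z_A x_B + x_A z_B) · #{r ≥ 1} + x_A x_B · #{r = 1} + (x_A y_B + y_A x_B) · #{r ≥ 1 ∧ b = 0}` -/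
lemma fc10 : flowCount (V2Closure.SP.ser (V2Closure.SP.par A B) Y) 1 0
    = ((Finset.univ.filter (fun a : A.Conf => A.rLab a = 0 ∧ A.bLab a = 0)).card * (Finset.univ.filter (fun b : B.Conf => B.rLab b = 1)).card
        + (Finset.univ.filter (fun a : A.Conf => A.rLab a = 1)).card * (Finset.univ.filter (fun b : B.Conf => B.rLab b = 0 ∧ B.bLab b = 0)).card)
        * (Finset.univ.filter (fun y : Y.Conf => 1 ≤ Y.rLab y)).card
      + (Finset.univ.filter (fun a : A.Conf => A.rLab a = 1)).card * (Finset.univ.filter (fun b : B.Conf => B.rLab b = 1)).card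
        * (Finset.univ.filter (fun y : Y.Conf => Y.rLab y = 1)).card
      + ((Finset.univ.filter (fun a : A.Conf => A.rLab a = 1)).card * (Finset.univ.filter (fun b : B.Conf => B.bLab b = 1)).card
        + (Finset.univ.filter (fun a : A.Conf => A.bLab a = 1)).card * (Finset.univ.filter (fun b : B.Conf => B.rLab b = 1)).card)
        * (Finset.univ.filter (fun y : Y.Conf => 1 ≤ Y.rLab y ∧ Y.bLab y = 0)).card := by
  unfold flowCount
  simp only [Finset.card_filter, add_mul]
  rw [← sum_prod_ite3 A B Y (fun a => A.rLab a = 0 ∧ A.bLab a = 0) (fun b => B.rLab b = 1) (fun y => 1 ≤ Y.rLab y),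
    ← sum_prod_ite3 A B Y (fun a => A.rLab a = 1) (fun b => B.rLab b = 0 ∧ B.bLab b = 0) (fun y => 1 ≤ Y.rLab y),
    ← sum_prod_ite3 A B Y (fun a => A.rLab a = 1) (fun b => B.rLab b = 1) (fun y => Y.rLab y = 1),
    ← sum_prod_ite3 A B Y (fun a => A.rLab a = 1) (fun b => B.bLab b = 1) (fun y => 1 ≤ Y.rLab y ∧ Y.bLab y = 0),
    ← sum_prod_ite3 A B Y (fun a => A.bLab a = 1) (fun b => B.rLab b = 1) (fun y => 1 ≤ Y.rLab y ∧ Y.bLab y = 0)]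
  change (∑ y : (A.Conf × B.Conf) × Y.Conf, if min (A.rLab y.1.1 + B.rLab y.1.2) (Y.rLab y.2) = 1
      ∧ min (A.bLab y.1.1 + B.bLab y.1.2) (Y.bLab y.2) = 0 then 1 else 0) = _
  rw [← Finset.sum_add_distrib, ← Finset.sum_add_distrib, ← Finset.sum_add_distrib, ← Finset.sum_add_distrib]
  refine Finset.sum_congr rfl (fun y _ => ?_)
  have h1 := hA y.1.1; have h2 := hB y.1.2
  split_ifs <;> omega

/-- `n₀₁ = (z_A y_B + y_A z_B) · #{b ≥ 1} + y_A y_B · #{b = 1} + (x_A y_B + y_A x_B) · #{b ≥ 1 ∧ r = 0}` -/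
lemma fc01 : flowCount (V2Closure.SP.ser (V2Closure.SP.par A B) Y) 0 1
    = ((Finset.univ.filter (fun a : A.Conf => A.rLab a = 0 ∧ A.bLab a = 0)).card * (Finset.univ.filter (fun b : B.Conf => B.bLab b = 1)).card
        + (Finset.univ.filter (fun a : A.Conf => A.bLab a = 1)).card * (Finset.univ.filter (fun b : B.Conf => B.rLab b = 0 ∧ B.bLab b = 0)).card)
        * (Finset.univ.filter (fun y : Y.Conf => 1 ≤ Y.bLab y)).card
      + (Finset.univ.filter (fun a : A.Conf => A.bLab a = 1)).card * (Finset.univ.filter (fun b : B.Conf => B.bLab b = 1)).card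
        * (Finset.univ.filter (fun y : Y.Conf => Y.bLab y = 1)).card
      + ((Finset.univ.filter (fun a : A.Conf => A.rLab a = 1)).card * (Finset.univ.filter (fun b : B.Conf => B.bLab b = 1)).card
        + (Finset.univ.filter (fun a : A.Conf => A.bLab a = 1)).card * (Finset.univ.filter (fun b : B.Conf => B.rLab b = 1)).card)
        * (Finset.univ.filter (fun y : Y.Conf => 1 ≤ Y.bLab y ∧ Y.rLab y = 0)).card := by
  unfold flowCount
  simp only [Finset.card_filter, add_mul]
  rw [← sum_prod_ite3 A B Y (fun a => A.rLab a = 0 ∧ A.bLab a = 0) (fun b => B.bLab b = 1) (fun y => 1 ≤ Y.bLab y),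
    ← sum_prod_ite3 A B Y (fun a => A.bLab a = 1) (fun b => B.rLab b = 0 ∧ B.bLab b = 0) (fun y => 1 ≤ Y.bLab y),
    ← sum_prod_ite3 A B Y (fun a => A.bLab a = 1) (fun b => B.bLab b = 1) (fun y => Y.bLab y = 1),
    ← sum_prod_ite3 A B Y (fun a => A.rLab a = 1) (fun b => B.bLab b = 1) (fun y => 1 ≤ Y.bLab y ∧ Y.rLab y = 0),
    ← sum_prod_ite3 A B Y (fun a => A.bLab a = 1) (fun b => B.rLab b = 1) (fun y => 1 ≤ Y.bLab y ∧ Y.rLab y = 0)]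
  change (∑ y : (A.Conf × B.Conf) × Y.Conf, if min (A.rLab y.1.1 + B.rLab y.1.2) (Y.rLab y.2) = 0
      ∧ min (A.bLab y.1.1 + B.bLab y.1.2) (Y.bLab y.2) = 1 then 1 else 0) = _
  rw [← Finset.sum_add_distrib, ← Finset.sum_add_distrib, ← Finset.sum_add_distrib, ← Finset.sum_add_distrib]
  refine Finset.sum_congr rfl (fun y _ => ?_)
  have h1 := hA y.1.1; have h2 := hB y.1.2
  split_ifs <;> omega

/-- `n₀₀ = z_A z_B · M + (z_A x_B + x_A z_B) · #{r = 0} + (z_A y_B + y_A z_B) · #{b = 0} + x_A x_B · #{r = 0}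
+ y_A y_B · #{b = 0} + (x_A y_B + y_A x_B) · #{r = b = 0}` -/
lemma fc00 : flowCount (V2Closure.SP.ser (V2Closure.SP.par A B) Y) 0 0
    = (Finset.univ.filter (fun a : A.Conf => A.rLab a = 0 ∧ A.bLab a = 0)).card
        * (Finset.univ.filter (fun b : B.Conf => B.rLab b = 0 ∧ B.bLab b = 0)).card * Fintype.card Y.Conf
      + ((Finset.univ.filter (fun a : A.Conf => A.rLab a = 0 ∧ A.bLab a = 0)).card * (Finset.univ.filter (fun b : B.Conf => B.rLab b = 1)).card
        + (Finset.univ.filter (fun a : A.Conf => A.rLab a = 1)).card * (Finset.univ.filter (fun b : B.Conf => B.rLab b = 0 ∧ B.bLab b = 0)).card)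
        * (Finset.univ.filter (fun y : Y.Conf => Y.rLab y = 0)).card
      + ((Finset.univ.filter (fun a : A.Conf => A.rLab a = 0 ∧ A.bLab a = 0)).card * (Finset.univ.filter (fun b : B.Conf => B.bLab b = 1)).card
        + (Finset.univ.filter (fun a : A.Conf => A.bLab a = 1)).card * (Finset.univ.filter (fun b : B.Conf => B.rLab b = 0 ∧ B.bLab b = 0)).card)
        * (Finset.univ.filter (fun y : Y.Conf => Y.bLab y = 0)).card
      + (Finset.univ.filter (fun a : A.Conf => A.rLab a = 1)).card * (Finset.univ.filter (fun b : B.Conf => B.rLab b = 1)).card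
        * (Finset.univ.filter (fun y : Y.Conf => Y.rLab y = 0)).card
      + (Finset.univ.filter (fun a : A.Conf => A.bLab a = 1)).card * (Finset.univ.filter (fun b : B.Conf => B.bLab b = 1)).card
        * (Finset.univ.filter (fun y : Y.Conf => Y.bLab y = 0)).card
      + ((Finset.univ.filter (fun a : A.Conf => A.rLab a = 1)).card * (Finset.univ.filter (fun b : B.Conf => B.bLab b = 1)).card
        + (Finset.univ.filter (fun a : A.Conf => A.bLab a = 1)).card * (Finset.univ.filter (fun b : B.Conf => B.rLab b = 1)).card)
        * (Finset.univ.filter (fun y : Y.Conf => Y.rLab y = 0 ∧ Y.bLab y = 0)).card := by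
  unfold flowCount
  have hM : Fintype.card Y.Conf = ∑ y : Y.Conf, if True then 1 else 0 := by simp
  rw [hM]
  simp only [Finset.card_filter, add_mul]
  rw [← sum_prod_ite3 A B Y (fun a => A.rLab a = 0 ∧ A.bLab a = 0) (fun b => B.rLab b = 0 ∧ B.bLab b = 0) (fun _ => True),
    ← sum_prod_ite3 A B Y (fun a => A.rLab a = 0 ∧ A.bLab a = 0) (fun b => B.rLab b = 1) (fun y => Y.rLab y = 0),
    ← sum_prod_ite3 A B Y (fun a => A.rLab a = 1) (fun b => B.rLab b = 0 ∧ B.bLab b = 0) (fun y => Y.rLab y = 0),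
    ← sum_prod_ite3 A B Y (fun a => A.rLab a = 0 ∧ A.bLab a = 0) (fun b => B.bLab b = 1) (fun y => Y.bLab y = 0),
    ← sum_prod_ite3 A B Y (fun a => A.bLab a = 1) (fun b => B.rLab b = 0 ∧ B.bLab b = 0) (fun y => Y.bLab y = 0),
    ← sum_prod_ite3 A B Y (fun a => A.rLab a = 1) (fun b => B.rLab b = 1) (fun y => Y.rLab y = 0),
    ← sum_prod_ite3 A B Y (fun a => A.bLab a = 1) (fun b => B.bLab b = 1) (fun y => Y.bLab y = 0),
    ← sum_prod_ite3 A B Y (fun a => A.rLab a = 1) (fun b => B.bLab b = 1) (fun y => Y.rLab y = 0 ∧ Y.bLab y = 0),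
    ← sum_prod_ite3 A B Y (fun a => A.bLab a = 1) (fun b => B.rLab b = 1) (fun y => Y.rLab y = 0 ∧ Y.bLab y = 0)]
  change (∑ y : (A.Conf × B.Conf) × Y.Conf, if min (A.rLab y.1.1 + B.rLab y.1.2) (Y.rLab y.2) = 0
      ∧ min (A.bLab y.1.1 + B.bLab y.1.2) (Y.bLab y.2) = 0 then 1 else 0) = _ + _ + _ + _ + _
  rw [← Finset.sum_add_distrib, ← Finset.sum_add_distrib, ← Finset.sum_add_distrib, ← Finset.sum_add_distrib,
    ← Finset.sum_add_distrib, ← Finset.sum_add_distrib, ← Finset.sum_add_distrib, ← Finset.sum_add_distrib]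
  refine Finset.sum_congr rfl (fun y _ => ?_)
  have h1 := hA y.1.1; have h2 := hB y.1.2
  rcases (by omega : (A.rLab y.1.1 = 0 ∧ A.bLab y.1.1 = 0) ∨ (A.rLab y.1.1 = 1 ∧ A.bLab y.1.1 = 0)
      ∨ (A.rLab y.1.1 = 0 ∧ A.bLab y.1.1 = 1)) with ⟨ha1, ha2⟩ | ⟨ha1, ha2⟩ | ⟨ha1, ha2⟩ <;>
  rcases (by omega : (B.rLab y.1.2 = 0 ∧ B.bLab y.1.2 = 0) ∨ (B.rLab y.1.2 = 1 ∧ B.bLab y.1.2 = 0)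
      ∨ (B.rLab y.1.2 = 0 ∧ B.bLab y.1.2 = 1)) with ⟨hb1, hb2⟩ | ⟨hb1, hb2⟩ | ⟨hb1, hb2⟩ <;>
  simp [ha1, ha2, hb1, hb2]

/-- `(A ∥ B) ∧ Y` has max-flow `≤ 2` -/
lemma flowLeTwo_serParCapOne : FlowLeTwo (V2Closure.SP.ser (V2Closure.SP.par A B) Y) := by
  intro y
  have h1 := hA y.1.1; have h2 := hB y.1.2
  change min (A.rLab y.1.1 + B.rLab y.1.2) (Y.rLab y.2) + min (A.bLab y.1.1 + B.bLab y.1.2) (Y.bLab y.2) ≤ 2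
  omega

end Counts

/-! ### The nine hypotheses as a predicate, and the transport rule for the family -/

/-- the nine transport hypotheses of `MTailPat.par_flow2'` for the flow counts of `Y`, in its order -/
def Nine (Y : V2Closure.SP) : Prop :=
  flowCount Y 0 0 * flowCount Y 2 0 ≤ flowCount Y 1 0 * flowCount Y 1 0 + flowCount Y 1 0 * flowCount Y 2 0 ∧
  flowCount Y 0 0 * flowCount Y 0 2 ≤ flowCount Y 0 1 * flowCount Y 0 1 + flowCount Y 0 1 * flowCount Y 0 2 ∧
  flowCount Y 2 0 * flowCount Y 0 2 ≤ flowCount Y 1 1 * flowCount Y 1 1 ∧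
  flowCount Y 2 0 * flowCount Y 0 1 ≤ flowCount Y 1 0 * flowCount Y 1 1 ∧
  flowCount Y 0 2 * flowCount Y 1 0 ≤ flowCount Y 0 1 * flowCount Y 1 1 ∧
  flowCount Y 0 0 * flowCount Y 2 0 ≤ flowCount Y 1 0 * flowCount Y 1 0 + flowCount Y 1 0 * flowCount Y 1 1 ∧
  flowCount Y 0 0 * flowCount Y 0 2 ≤ flowCount Y 0 1 * flowCount Y 0 1 + flowCount Y 0 1 * flowCount Y 1 1 ∧
  flowCount Y 0 0 * flowCount Y 1 1 ≤ flowCount Y 1 0 * flowCount Y 0 1 + flowCount Y 0 1 * flowCount Y 2 0 ∧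
  flowCount Y 0 0 * flowCount Y 1 1 ≤ flowCount Y 1 0 * flowCount Y 0 1 + flowCount Y 1 0 * flowCount Y 0 2

/-- **the nine hypotheses hold for `(A ∥ B) ∧ Y`** for capacity-one `A`, `B` and every `Y` -/
theorem nine_serCapOne (A B Y : V2Closure.SP) (hA : FlowLeOne A) (hB : FlowLeOne B) :
    Nine (V2Closure.SP.ser (V2Closure.SP.par A B) Y) := by
  -- the swap on the pieces and on `Y`
  have sA : (Finset.univ.filter (fun a : A.Conf => A.bLab a = 1)).card = (Finset.univ.filter (fun a : A.Conf => A.rLab a = 1)).card :=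
    card_swap A (fun r _ => r = 1)
  have sB : (Finset.univ.filter (fun b : B.Conf => B.bLab b = 1)).card = (Finset.univ.filter (fun b : B.Conf => B.rLab b = 1)).card :=
    card_swap B (fun r _ => r = 1)
  have y2 : (Finset.univ.filter (fun y : Y.Conf => 2 ≤ Y.bLab y)).card = (Finset.univ.filter (fun y : Y.Conf => 2 ≤ Y.rLab y)).card :=
    card_swap Y (fun r _ => 2 ≤ r)
  have y1 : (Finset.univ.filter (fun y : Y.Conf => 1 ≤ Y.bLab y)).card = (Finset.univ.filter (fun y : Y.Conf => 1 ≤ Y.rLab y)).card :=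
    card_swap Y (fun r _ => 1 ≤ r)
  have yq : (Finset.univ.filter (fun y : Y.Conf => Y.bLab y = 1)).card = (Finset.univ.filter (fun y : Y.Conf => Y.rLab y = 1)).card :=
    card_swap Y (fun r _ => r = 1)
  have yx : (Finset.univ.filter (fun y : Y.Conf => 1 ≤ Y.bLab y ∧ Y.rLab y = 0)).card
      = (Finset.univ.filter (fun y : Y.Conf => 1 ≤ Y.rLab y ∧ Y.bLab y = 0)).card :=
    card_swap Y (fun r b => 1 ≤ r ∧ b = 0)
  have yp := card_b0_eq_r0 Y
  -- the six counts
  have e20 := fc20 A B Y hA hB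
  have e02 := fc02 A B Y hA hB
  have e11 := fc11 A B Y hA hB
  have e10 := fc10 A B Y hA hB
  have e01 := fc01 A B Y hA hB
  have e00 := fc00 A B Y hA hB
  rw [sA, sB, y2] at e02
  rw [sA, sB] at e11
  rw [sA, sB] at e10
  rw [sA, sB, y1, yq, yx] at e01
  rw [sA, sB, yp] at e00
  -- the statistics of `Y` and the theorems of the grammar
  have hIII := third_count Y
  simp only [stat] at hIII
  rw [card_b0_eq_r0 Y] at hIII
  have hI := disjoint_le_conn Y
  have hH := harris_count Y
  have r1 := card_r1_add Y
  have r2 := card_r1_split Y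
  have r3 := card_conn_add Y
  have r5 : (Finset.univ.filter (fun y : Y.Conf => 1 ≤ Y.rLab y ∧ Y.bLab y = 0)).card
      + (Finset.univ.filter (fun y : Y.Conf => 1 ≤ Y.rLab y ∧ 1 ≤ Y.bLab y)).card
      = (Finset.univ.filter (fun y : Y.Conf => 1 ≤ Y.rLab y)).card := by
    have := card_rt_split Y 1; omega
  rw [card_b0_eq_r0 Y] at r3
  set xA := (Finset.univ.filter (fun a : A.Conf => A.rLab a = 1)).card
  set xB := (Finset.univ.filter (fun b : B.Conf => B.rLab b = 1)).card
  set zA := (Finset.univ.filter (fun a : A.Conf => A.rLab a = 0 ∧ A.bLab a = 0)).card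
  set zB := (Finset.univ.filter (fun b : B.Conf => B.rLab b = 0 ∧ B.bLab b = 0)).card
  set M := Fintype.card Y.Conf
  set a₁ := (Finset.univ.filter (fun y : Y.Conf => 1 ≤ Y.rLab y)).card
  set a₂ := (Finset.univ.filter (fun y : Y.Conf => 2 ≤ Y.rLab y)).card
  set c := (Finset.univ.filter (fun y : Y.Conf => 1 ≤ Y.rLab y ∧ 1 ≤ Y.bLab y)).card
  set Q := (Finset.univ.filter (fun y : Y.Conf => Y.rLab y = 1)).card
  set P := (Finset.univ.filter (fun y : Y.Conf => Y.rLab y = 0)).card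
  set Z := (Finset.univ.filter (fun y : Y.Conf => Y.rLab y = 0 ∧ Y.bLab y = 0)).card
  set X := (Finset.univ.filter (fun y : Y.Conf => 1 ≤ Y.rLab y ∧ Y.bLab y = 0)).card
  set n00 := flowCount (V2Closure.SP.ser (V2Closure.SP.par A B) Y) 0 0
  set n10 := flowCount (V2Closure.SP.ser (V2Closure.SP.par A B) Y) 1 0
  set n01 := flowCount (V2Closure.SP.ser (V2Closure.SP.par A B) Y) 0 1
  set n20 := flowCount (V2Closure.SP.ser (V2Closure.SP.par A B) Y) 2 0
  set n02 := flowCount (V2Closure.SP.ser (V2Closure.SP.par A B) Y) 0 2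
  set n11 := flowCount (V2Closure.SP.ser (V2Closure.SP.par A B) Y) 1 1
  have hH' : (c : ℤ) * M ≤ a₁ ^ 2 := by
    have h1 : (Z : ℤ) * M ≤ P ^ 2 := by exact_mod_cast hH
    have h2 : (c : ℤ) + P + P = M + Z := by exact_mod_cast r3
    have h3 : (a₁ : ℤ) + P = M := by exact_mod_cast r1
    have hC : (c : ℤ) = M + Z - 2 * P := by linarith
    have hA' : (a₁ : ℤ) = M - P := by linarith
    rw [hC, hA']; linarith [h1]
  have alg := capone_alg (n00 : ℤ) n10 n20 n11 xA xB zA zB M a₁ a₂ c Q P Z X (by positivity) (by positivity)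
    (by positivity) (by positivity) (by positivity) (by positivity) (by positivity) (by positivity) (by positivity)
    (by positivity) (by positivity) (by positivity) (by exact_mod_cast e20) (by exact_mod_cast e11)
    (by exact_mod_cast e10) (by exact_mod_cast e00) (by exact_mod_cast r2) (by exact_mod_cast r1)
    (by exact_mod_cast r3) (by exact_mod_cast r5) (by exact_mod_cast hIII) hH' (by exact_mod_cast hI)
  obtain ⟨hR2, hS, hE, hR1, hΛ⟩ := alg
  have hn02 : n02 = n20 := by rw [e02, e20]
  have hn01 : n01 = n10 := by rw [e01, e10]
  unfold Nine
  refine ⟨?_, ?_, ?_, ?_, ?_, ?_, ?_, ?_, ?_⟩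
  · show n00 * n20 ≤ n10 * n10 + n10 * n20
    exact_mod_cast hR2
  · show n00 * n02 ≤ n01 * n01 + n01 * n02
    rw [hn02, hn01]; exact_mod_cast hR2
  · show n20 * n02 ≤ n11 * n11
    rw [hn02]; exact_mod_cast hS
  · show n20 * n01 ≤ n10 * n11
    rw [hn01]; exact_mod_cast hE
  · show n02 * n10 ≤ n01 * n11
    rw [hn02, hn01]; exact_mod_cast hE
  · show n00 * n20 ≤ n10 * n10 + n10 * n11
    exact_mod_cast hR1
  · show n00 * n02 ≤ n01 * n01 + n01 * n11
    rw [hn02, hn01]; exact_mod_cast hR1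
  · show n00 * n11 ≤ n10 * n01 + n01 * n20
    rw [hn01]; exact_mod_cast hΛ
  · show n00 * n11 ≤ n10 * n01 + n10 * n02
    rw [hn02, hn01]; exact_mod_cast hΛ

/-- **parallel composition with `(A ∥ B) ∧ Y` keeps the M♮ class** for capacity-one `A`, `B` that can
carry flow and every pattern `Y` attaining `r ≥ 2`, `b ≥ 2` and `r, b ≥ 1`. -/
theorem MTailPat.par_serCapOne {s : V2Closure.SP} {L : ℤ} (hs : MTailPat s L) (A B Y : V2Closure.SP)
    (hA : FlowLeOne A) (hB : FlowLeOne B) (hA1 : ∃ a : A.Conf, A.rLab a = 1) (hB1 : ∃ b : B.Conf, B.rLab b = 1)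
    (h20 : ∃ y : Y.Conf, 2 ≤ Y.rLab y) (h02 : ∃ y : Y.Conf, 2 ≤ Y.bLab y)
    (h11 : ∃ y : Y.Conf, 1 ≤ Y.rLab y ∧ 1 ≤ Y.bLab y) :
    MTailPat (.par s (.ser (.par A B) Y)) (L + 2) ∧ MTailPat (.par (.ser (.par A B) Y) s) (L + 2) := by
  obtain ⟨hR2, hC2, hS, hE, hE', hR1, hC1, hΛa, hΛb⟩ := nine_serCapOne A B Y hA hB
  -- non-degeneracy of the composite
  obtain ⟨a0, ha0⟩ := hA1
  obtain ⟨b0, hb0⟩ := hB1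
  obtain ⟨y20, hy20⟩ := h20
  obtain ⟨y02, hy02⟩ := h02
  obtain ⟨y11, hy11⟩ := h11
  have ha0' := hA a0
  have hb0' := hB b0
  have hsa : A.rLab (swapConf A a0) = 0 ∧ A.bLab (swapConf A a0) = 1 := by
    rw [rLab_swapConf, bLab_swapConf]; omega
  have hsb : B.rLab (swapConf B b0) = 0 ∧ B.bLab (swapConf B b0) = 1 := by
    rw [rLab_swapConf, bLab_swapConf]; omega
  have t20 : ∃ y : (V2Closure.SP.ser (V2Closure.SP.par A B) Y).Conf,
      (V2Closure.SP.ser (V2Closure.SP.par A B) Y).rLab y = 2 ∧ (V2Closure.SP.ser (V2Closure.SP.par A B) Y).bLab y = 0 :=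
    ⟨((a0, b0), y20), by
      change min (A.rLab a0 + B.rLab b0) (Y.rLab y20) = 2 ∧ min (A.bLab a0 + B.bLab b0) (Y.bLab y20) = 0
      omega⟩
  have t02 : ∃ y : (V2Closure.SP.ser (V2Closure.SP.par A B) Y).Conf,
      (V2Closure.SP.ser (V2Closure.SP.par A B) Y).rLab y = 0 ∧ (V2Closure.SP.ser (V2Closure.SP.par A B) Y).bLab y = 2 :=
    ⟨((swapConf A a0, swapConf B b0), y02), by
      change min (A.rLab (swapConf A a0) + B.rLab (swapConf B b0)) (Y.rLab y02) = 0
        ∧ min (A.bLab (swapConf A a0) + B.bLab (swapConf B b0)) (Y.bLab y02) = 2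
      omega⟩
  have t11 : ∃ y : (V2Closure.SP.ser (V2Closure.SP.par A B) Y).Conf,
      (V2Closure.SP.ser (V2Closure.SP.par A B) Y).rLab y = 1 ∧ (V2Closure.SP.ser (V2Closure.SP.par A B) Y).bLab y = 1 :=
    ⟨((a0, swapConf B b0), y11), by
      change min (A.rLab a0 + B.rLab (swapConf B b0)) (Y.rLab y11) = 1
        ∧ min (A.bLab a0 + B.bLab (swapConf B b0)) (Y.bLab y11) = 1
      omega⟩
  exact MTailPat.par_flow2' hs _ (flowLeTwo_serParCapOne A B Y hA hB) t20 t11 t02 hR2 hC2 hS hE hE' hR1 hC1 hΛa hΛb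

end Summit.Ventures.PercRepro2.Tail2D
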